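import Mathlib
import Summits.KontsevichZagierPeriods.Zeta5Search.FourthOrderFrame
import Summits.KontsevichZagierPeriods.Zeta5Search.PadicCoeffBound
import HarnessLib

/-!
# ζ(5) search — TAYLOR COEFFICIENTS at the frame centre and the ODD-PART expansion (tools for THEOREM L5)

Cell `pub-zeta5` (HONEST FRAMING: systematic search; no irrationality claim unless certified), typer seat generation 13.
REPORT-gen2-g14 §2, Lemma P: for a polynomial `H` of degree `≤ 6` and the reflection `H^r(X) = H(L − X)`,
`H − H^r = Σ_{n odd ≤ 5} 2 h_n (X − L/2)^n` with `h_n` the Taylor coefficients of `H` at `L/2` (`oddPart_eq`); hence for every additive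
`ℚ`-homogeneous functional `F` (the frame functionals `ŵ[·Φ_T]`, `v̂[·Φ_T]`):
`F(H − H^r) = 2h₁ F(X − L/2) + 2h₃ F((X − L/2)³) + 2h₅ F((X − L/2)⁵)` (`framePoly_oddPart`).
Plus the `p`-adic bookkeeping of Taylor coefficients (`taylor_coeff_eq_sum`, `padicNorm_taylor_coeff_le`,
`padicNorm_taylor_coeff_sub_le`: `h_n` is a binomial combination of the coefficients `H_m`, `m ≥ n`, so it inherits their bounds, and
`h_n − H_n` those of `H_m`, `m > n`).  Algebra over `ℚ` and `p`-adic norms; nothing here bears on irrationality.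
-/

noncomputable section

open Finset

namespace Summit.KontsevichZagierPeriods.Zeta5Search.SecondOrder

open Summit.KontsevichZagierPeriods.Zeta5Search.PadicSeries

variable {p : ℕ} [hp : Fact p.Prime]

/-! ## §1 Taylor coefficients as binomial sums -/

omit hp in
/-- **`(taylor r f)_n = Σ_{m<N} C(m+n, n) f_{m+n} r^m`** for `deg f < N`. -/
theorem taylor_coeff_eq_sum (f : Polynomial ℚ) (r : ℚ) (n : ℕ) {N : ℕ} (hN : f.natDegree < N) :
    (Polynomial.taylor r f).coeff n = ∑ m ∈ range N, ((m + n).choose n : ℚ) * f.coeff (m + n) * r ^ m := by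
  rw [Polynomial.taylor_coeff,
    Polynomial.eval_eq_sum_range' (lt_of_le_of_lt (Polynomial.natDegree_hasseDeriv_le f n) (by omega : f.natDegree - n < N))]
  refine sum_congr rfl fun m _ => ?_
  rw [Polynomial.hasseDeriv_coeff]

/-- **Taylor coefficients inherit coefficient bounds**: `‖r‖ ≤ 1` and `‖f_m‖ ≤ B` for all `m ≥ n` give `‖(taylor r f)_n‖ ≤ B`. -/
theorem padicNorm_taylor_coeff_le (f : Polynomial ℚ) {r : ℚ} (hr : padicNorm p r ≤ 1) (n : ℕ) {B : ℚ} (hB : 0 ≤ B)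
    (hf : ∀ m, n ≤ m → padicNorm p (f.coeff m) ≤ B) : padicNorm p ((Polynomial.taylor r f).coeff n) ≤ B := by
  rw [taylor_coeff_eq_sum f r n (Nat.lt_succ_self _)]
  refine padicNorm.sum_le' (fun m _ => ?_) hB
  rw [padicNorm.mul, padicNorm.mul]
  have h1 : padicNorm p ((m + n).choose n : ℚ) ≤ 1 := by simpa using padicNorm.of_nat (p := p) ((m + n).choose n)
  have h2 : padicNorm p (r ^ m) ≤ 1 := by
    rw [CellA.padicNorm_pow_eq]; exact pow_le_one₀ (padicNorm.nonneg _) hr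
  calc padicNorm p ((m + n).choose n : ℚ) * padicNorm p (f.coeff (m + n)) * padicNorm p (r ^ m) ≤ 1 * B * 1 :=
        mul_le_mul (mul_le_mul h1 (hf (m + n) (by omega)) (padicNorm.nonneg _) zero_le_one) h2 (padicNorm.nonneg _)
          (mul_nonneg zero_le_one hB)
    _ = B := by ring

/-- **The Taylor coefficient minus the plain coefficient** is bounded by the coefficients of HIGHER degree. -/
theorem padicNorm_taylor_coeff_sub_le (f : Polynomial ℚ) {r : ℚ} (hr : padicNorm p r ≤ 1) (n : ℕ) {B : ℚ} (hB : 0 ≤ B)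
    (hf : ∀ m, n < m → padicNorm p (f.coeff m) ≤ B) : padicNorm p ((Polynomial.taylor r f).coeff n - f.coeff n) ≤ B := by
  rw [taylor_coeff_eq_sum f r n (Nat.lt_succ_self _), sum_range_succ']
  simp only [zero_add, Nat.choose_self, Nat.cast_one, one_mul, pow_zero, mul_one, add_sub_cancel_right]
  refine padicNorm.sum_le' (fun m _ => ?_) hB
  rw [padicNorm.mul, padicNorm.mul]
  have h1 : padicNorm p ((m + 1 + n).choose n : ℚ) ≤ 1 := by simpa using padicNorm.of_nat (p := p) ((m + 1 + n).choose n)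
  have h2 : padicNorm p (r ^ (m + 1)) ≤ 1 := by
    rw [CellA.padicNorm_pow_eq]; exact pow_le_one₀ (padicNorm.nonneg _) hr
  calc padicNorm p ((m + 1 + n).choose n : ℚ) * padicNorm p (f.coeff (m + 1 + n)) * padicNorm p (r ^ (m + 1)) ≤ 1 * B * 1 :=
        mul_le_mul (mul_le_mul h1 (hf _ (by omega)) (padicNorm.nonneg _) zero_le_one) h2 (padicNorm.nonneg _)
          (mul_nonneg zero_le_one hB)
    _ = B := by ring

/-! ## §2 The odd part of `H − H(L − X)` -/

omit hp in
/-- Taylor's formula as a finite sum over `range N` (`deg H < N`). -/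
theorem eq_sum_taylor (H : Polynomial ℚ) (r : ℚ) {N : ℕ} (hN : H.natDegree < N) :
    H = ∑ n ∈ range N, Polynomial.C ((Polynomial.taylor r H).coeff n) * (Polynomial.X - Polynomial.C r) ^ n := by
  conv_lhs => rw [← Polynomial.sum_taylor_eq H r]
  rw [Polynomial.sum_over_range' _ (fun i => by simp) N (by rwa [Polynomial.natDegree_taylor])]

omit hp in
/-- **The odd part**: `H − H(2r − X) = Σ_{n<N, n odd} 2 h_n (X − r)^n` (`h_n` the Taylor coefficients at `r`, `deg H < N`). -/
theorem oddPart_eq (H : Polynomial ℚ) (r : ℚ) {N : ℕ} (hN : H.natDegree < N) :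
    H - H.comp (Polynomial.C (2 * r) - Polynomial.X) =
      ∑ n ∈ range N, if n % 2 = 1 then Polynomial.C (2 * (Polynomial.taylor r H).coeff n) * (Polynomial.X - Polynomial.C r) ^ n
        else 0 := by
  have hT := eq_sum_taylor H r hN
  conv_lhs => rw [hT]
  rw [Polynomial.sum_comp, ← sum_sub_distrib]
  refine sum_congr rfl fun n _ => ?_
  rw [Polynomial.mul_comp, Polynomial.C_comp, Polynomial.pow_comp, Polynomial.sub_comp, Polynomial.X_comp, Polynomial.C_comp,
    show Polynomial.C (2 * r) - Polynomial.X - Polynomial.C r = -(Polynomial.X - Polynomial.C r) by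
      rw [map_mul, show (Polynomial.C (2 : ℚ)) = 2 from rfl]; ring,
    neg_pow]
  rcases Nat.even_or_odd n with he | ho
  · rw [if_neg (by rcases he with ⟨k, hk⟩; omega), he.neg_one_pow]; ring
  · rw [if_pos (by rcases ho with ⟨k, hk⟩; omega), ho.neg_one_pow, map_mul, map_ofNat]; ring

omit hp in
/-- **The odd part through an additive homogeneous functional**, degree `≤ 6`:
`F(H − H(2r − X)) = 2h₁F(X − r) + 2h₃F((X − r)³) + 2h₅F((X − r)⁵)`. -/
theorem framePoly_oddPart (F : Polynomial ℚ → ℚ) (hadd : ∀ G H, F (G + H) = F G + F H)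
    (hC : ∀ (c : ℚ) G, F (Polynomial.C c * G) = c * F G) (H : Polynomial ℚ) (hH : H.natDegree ≤ 6) (r : ℚ) :
    F (H - H.comp (Polynomial.C (2 * r) - Polynomial.X)) =
      2 * (Polynomial.taylor r H).coeff 1 * F (Polynomial.X - Polynomial.C r)
        + 2 * (Polynomial.taylor r H).coeff 3 * F ((Polynomial.X - Polynomial.C r) ^ 3)
        + 2 * (Polynomial.taylor r H).coeff 5 * F ((Polynomial.X - Polynomial.C r) ^ 5) := by
  have hF0 : F 0 = 0 := by have := hC 0 0; rwa [map_zero, zero_mul, zero_mul] at this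
  have hsum : ∀ (s : Finset ℕ) (G : ℕ → Polynomial ℚ), F (∑ n ∈ s, G n) = ∑ n ∈ s, F (G n) := by
    intro s G
    induction s using Finset.induction_on with
    | empty => rw [sum_empty, sum_empty, hF0]
    | insert a s ha ih => rw [sum_insert ha, sum_insert ha, hadd, ih]
  have hite : ∀ (c : Prop) [Decidable c] (G : Polynomial ℚ), F (if c then G else 0) = if c then F G else 0 := by
    intro c _ G; split_ifs <;> simp [hF0]
  rw [oddPart_eq H r (show H.natDegree < 7 by omega), hsum]
  simp only [hite, hC, sum_range_succ, sum_range_zero, zero_add, Nat.zero_mod, Nat.one_mod, Nat.reduceMod, zero_ne_one,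
    if_false, if_true, add_zero, pow_one]

end Summit.KontsevichZagierPeriods.Zeta5Search.SecondOrder

end
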